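import Literature.AnabelianGeometry.SemiGraphs.TemperedPiRayApartmentAbuts
import Literature.AnabelianGeometry.SemiGraphs.TemperedPiBranchStabilizerImage
import Literature.AnabelianGeometry.SemiGraphs.TemperedPiDecompositionConj
import HarnessLib

/-!
# Transport of a local frame across a fixed edge of a tree of a Galois tower ([SemiAnbd] Rmk 2.2.1, Thm 3.7 (iii))

Mochizuki, *Semi-graphs of anabelioids*, Publ. RIMS **42** (2006), Remark 2.2.1 p. 24 (branch stabilisers are
conjugates of the branch subgroups) and Theorem 3.7 (iii)/(iv) pp. 40–41
[cite: MochizukiSemiAnbd2006, Rmk 2.2.1 p.24].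

PROOF-ONLY file (abc-iut cell, layer L3, seat abc-iut-L3-d4 gen 5; row «B9·ANCHOR-FREE-PAIR@𝒢_θ», brick K-B2;
frontier / erratum-grade label — it serves the typed-form audit of the cell's ∀-countable typing of Thm 3.7
(iv) at the countermodel `𝒢_θ`, OUTSIDE the [IUTchIII] Cor. 3.12 cone; 0 definitions, no named fact).  Desk
memo `HOME/staging/L3/L3-d4/g5/B9-ANCHOR-FREE-PAIR.md`, step (S1b).

GENERIC over a Galois tower `D : GaloisLevelData 𝒢` of a connected `𝒢` (abc-iut-L3-t9/t6/t11/w5-d160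
vocabulary, consumed BY NAME: `PointSeq`, `smul`, `decompHom_smul`, `toEdgeSeq`, `EdgeSeq.gluePointSeq`,
`decompHomE_toEdgeSeq`, `decompHomE_apply_of_eq`, `joins_edge_gluePointSeq_vertex`, `CovObj.brOf`,
`exists_eq_brOf`, `branchMap_brOf`, `brOf_eq_brOf_iff`, `eq_gal`):

* `PointSeq.exists_transport_of_branchMap_eq` — **TRANSPORT ACROSS A FIXED BRANCH**: if `g ∈ π₁^temp(𝒢)`
  fixes, at level `N`, a branch `β` of the tree `𝔾̃_N` abutting to `P.vertex N` and lying over the branch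
  `b` of `𝔾` at `w`, and `b'` is the other branch of the edge of `b`, abutting to `w'`, then there are a
  point sequence `P'` over `w'`, `f ∈ Π_w` and `k ∈ Π_e` with
  (frame) `ρ_N(g) = σ_N^{f·b_*(k)·f⁻¹}` at `P`;
  (alignment) `P'.decompHom (b'_*(x)) = P.decompHom (f·b_*(x)·f⁻¹)` for every `x ∈ Π_e` (the edge
  group read at `b'` resp. transported to `b` along `edgeOf b' = edgeOf b`)
  — at EVERY level, with NO conjugator choice;
  (adjacency) the tree edge of `β` joins `P.vertex N` to `P'.vertex N`, which are distinct.

Nothing of [SemiAnbd] is asserted; nothing bears on [IUTchIII] Cor. 3.12; typed ≠ proved.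
-/

namespace Literature.AnabelianGeometry.SemiGraphs

namespace ProfiniteSemiGraph

namespace GaloisLevelData

open CategoryTheory Topology
open Literature.AlgebraicGeometry.Frobenioids.QuasiTemperoid.BTempConnected (ρ_one_apply
  ρ_mul_apply ρ_inv_apply)

universe u

variable {𝒢 : ProfiniteSemiGraph.{u}} {D : GaloisLevelData 𝒢} {h𝒢 : 𝒢.IsCountable}

namespace PointSeq

variable {w : 𝒢.graph.Vertex} (P : D.PointSeq h𝒢 w)

/-- The points of the translate of `P` by the decomposition image of `h⁻¹` are `h · P.pt n`.
[cite: MochizukiSemiAnbd2006, Thm 3.7(i) p.40] -/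
theorem smul_decompHom_inv_pt (h : 𝒢.Gv w) (n : ℕ) :
    (P.smul (P.decompHom h⁻¹)).pt n = ((D.cover h𝒢 n).SV w).obj.ρ h (P.pt n) := by
  rw [P.smul_pt, P.proj_decompHom, P.gal_apply, inv_inv]

/-- The translate of `P` by a decomposition image has the same tree vertices.
[cite: MochizukiSemiAnbd2006, Thm 3.7(iii) p.41] -/
theorem smul_decompHom_vertex (h : 𝒢.Gv w) (n : ℕ) :
    (P.smul (P.decompHom h)).vertex n = P.vertex n := by
  rw [P.smul_vertex, P.treeAct_decompHom_vertexMap]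

/-- The decomposition homomorphism of the translate by `ψ(h⁻¹)` is `x ↦ ψ(h⁻¹ x h)`.
[cite: MochizukiSemiAnbd2006, Thm 3.7(i) p.40] -/
theorem decompHom_smul_decompHom_inv (h x : 𝒢.Gv w) :
    (P.smul (P.decompHom h⁻¹)).decompHom x = P.decompHom (h⁻¹ * x * h) := by
  rw [P.decompHom_smul, map_mul, map_mul, map_inv, inv_inv]

/-- **TRANSPORT OF A LOCAL FRAME ACROSS A FIXED BRANCH** ([SemiAnbd] Rmk 2.2.1 + Def. 3.5 (i) at one level of a
Galois tower, generic): see the module docstring. [cite: MochizukiSemiAnbd2006, Rmk 2.2.1 p.24] -/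
theorem exists_transport_of_branchMap_eq (hc : 𝒢.graph.IsConnected) (N : ℕ) (g : D.temperedPi h𝒢)
    (b : 𝒢.graph.Branch) (hb : 𝒢.graph.abuts b = some w)
    (b' : 𝒢.graph.Branch) (hbb' : b ≠ b') (hb'e : 𝒢.graph.edgeOf b' = 𝒢.graph.edgeOf b)
    (w' : 𝒢.graph.Vertex) (hb' : 𝒢.graph.abuts b' = some w')
    (β : (D.tree N).Branch) (hβb : (D.treeProj N).branchMap β = b)
    (hβ : (D.tree N).abuts β = some (P.vertex N))
    (hfix : (D.treeAct h𝒢 N g).hom.branchMap β = β) :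
    ∃ (P' : D.PointSeq h𝒢 w') (f : 𝒢.Gv w) (k : 𝒢.Ge (𝒢.graph.edgeOf b)),
      D.proj h𝒢 N g = P.gal N (f * 𝒢.brHom b w hb k * f⁻¹) ∧
      (∀ x : 𝒢.Ge (𝒢.graph.edgeOf b'),
        P'.decompHom (𝒢.brHom b' w' hb' x) = P.decompHom (f * 𝒢.brHom b w hb (hb'e ▸ x) * f⁻¹)) ∧
      (D.tree N).Joins ((D.tree N).edgeOf β) (P.vertex N) (P'.vertex N) ∧
      P.vertex N ≠ P'.vertex N := by
  -- cover coordinates of `β`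
  set β₀ := (D.treeIso h𝒢 N).inv.branchMap β with hβ₀
  have hβeq : β = (D.treeIso h𝒢 N).hom.branchMap β₀ := (D.treeIso_hom_branchMap_inv h𝒢 N β).symm
  have hβ₀b : (D.cover h𝒢 N).orbitGraphProj.branchMap β₀ = b := by
    rw [← hβb, hβeq, D.treeProj_branchMap_treeIso h𝒢]; rfl
  obtain ⟨y, hy⟩ := (D.cover h𝒢 N).exists_eq_brOf b hb β₀ hβ₀b
  -- `β₀` abuts to the orbit of `P.pt N`, hence `y = gᵥ · P.pt N`
  have hβ₀abuts : (D.cover h𝒢 N).orbitGraph.abuts β₀ = some (Quot.mk _ ⟨w, P.pt N⟩) := by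
    apply D.orbitGraph_abuts_of_tree_abuts h𝒢
    rw [← hβeq]
    exact hβ
  rw [hy, (D.cover h𝒢 N).abuts_brOf b hb y] at hβ₀abuts
  obtain ⟨gᵥ, hgᵥ⟩ := (D.cover h𝒢 N).exists_ρ_of_mk_eq_mk (Option.some.inj hβ₀abuts).symm
  -- recentre: `P_y := gᵥ · P`, `P_y.pt N = y`, `ψ_{P_y}(x) = ψ_P(gᵥ⁻¹ x gᵥ)`
  set P_y := P.smul (P.decompHom gᵥ⁻¹) with hP_y
  have hPy_pt : P_y.pt N = y := by rw [hP_y, P.smul_decompHom_inv_pt, hgᵥ]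
  have hPy_vertex : P_y.vertex N = P.vertex N := P.smul_decompHom_vertex gᵥ⁻¹ N
  have hPy_decomp : ∀ x, P_y.decompHom x = P.decompHom (gᵥ⁻¹ * x * gᵥ) :=
    fun x => P.decompHom_smul_decompHom_inv gᵥ x
  -- the frame at `P_y`: `ρ_N(g) = σ_N^{b_*(k)}`
  have hfix₀ : (CovObj.orbitGraphMap (D.proj h𝒢 N g).hom).branchMap β₀ = β₀ := by
    have h1 := hfix
    rw [D.treeAct_apply, hβeq, D.galTreeAct_branchMap_treeIso h𝒢] at h1
    have h2 := congrArg (D.treeIso h𝒢 N).inv.branchMap h1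
    rwa [D.treeIso_inv_branchMap_hom h𝒢, D.treeIso_inv_branchMap_hom h𝒢] at h2
  rw [hy, (D.cover h𝒢 N).branchMap_brOf b hb, (D.cover h𝒢 N).brOf_eq_brOf_iff b hb] at hfix₀
  obtain ⟨_, ⟨k, rfl⟩, hk⟩ := hfix₀
  have hkk : (𝒢.brHom b w hb).toMonoidHom k = 𝒢.brHom b w hb k := rfl
  rw [hkk] at hk
  have hk' : ((D.proj h𝒢 N g).hom.fV w).hom.hom y =
      ((D.cover h𝒢 N).SV w).obj.ρ (𝒢.brHom b w hb k)⁻¹ y := by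
    have h2 := congrArg (((D.cover h𝒢 N).SV w).obj.ρ (𝒢.brHom b w hb k)⁻¹) hk
    rw [← ρ_mul_apply, inv_mul_cancel, ρ_one_apply] at h2
    exact h2
  have hframe_y : D.proj h𝒢 N g = P_y.gal N (𝒢.brHom b w hb k) := by
    apply P_y.eq_gal
    rw [hPy_pt]
    exact hk'
  -- transport across the edge: un-glue along `b`, glue along `b'`
  set Q := P_y.toEdgeSeq b hb with hQ
  have hQglue : Q.gluePointSeq b w hb rfl = P_y := P_y.gluePointSeq_toEdgeSeq b hb
  refine ⟨Q.gluePointSeq b' w' hb' hb'e, gᵥ⁻¹, k, ?_, ?_, ?_, ?_⟩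
  · -- frame at `P`
    rw [hframe_y, ← P_y.proj_decompHom, hPy_decomp, ← P.proj_decompHom, inv_inv]
  · -- alignment
    intro x
    rw [← Q.decompHomE_apply_of_eq hc b' w' hb' hb'e x, hQ, P_y.decompHomE_toEdgeSeq b hb hc,
      MonoidHom.comp_apply, hPy_decomp, inv_inv]
    rfl
  · -- adjacency: the tree edge of `β` is `Q.edge N`, which joins `P_y.vertex N = P.vertex N` to the new vertex
    have hbr : (D.cover h𝒢 N).brOf b hb y =
        ⟨(b, Quot.mk _ ⟨𝒢.graph.edgeOf b, Q.pt N⟩), rfl⟩ := by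
      rw [hQ, P_y.toEdgeSeq_pt, hPy_pt]; rfl
    have hedge : (D.tree N).edgeOf β = Q.edge N := by
      rw [hβeq, hy, hbr]; exact Q.edgeOf_treeIso_branchMap b rfl N
    have hj := Q.joins_edge_gluePointSeq_vertex N b b' hbb' w w' hb hb' rfl hb'e
    rw [hQglue, hPy_vertex] at hj
    rw [hedge]
    exact hj
  · have hne := Q.gluePointSeq_vertex_ne N b b' hbb' w w' hb hb' rfl hb'e
    rwa [hQglue, hPy_vertex] at hne

end PointSeq

end GaloisLevelData

end ProfiniteSemiGraph

end Literature.AnabelianGeometry.SemiGraphs
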